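import Literature.MathematicalPhysics.QuantumFieldTheory.Balaban1983to89.B7Prop5GeneralLevels

/-!
# `Balaban1983to89.B7Prop5WindowNumerics` — [B7] Proposition 4 p. 38, (145) p. 40, (155) p. 41, Proposition 5 p. 42 with [B9] (3.35) p. 396: **THE SMALLNESS WINDOW
# IS INHABITED** — explicit `α₀′(d,L)`, `b(d,L)`, threshold `a`, and `κ_C`, for every dimension `d + 1 ≥ 1` and block size `L = ℓ + 1 ≥ 2`

T. Bałaban, *Averaging operations for lattice gauge theories*, Commun. Math. Phys. **98** (1985) 17–51 [`Balaban1985Averaging`, "B7"]; T. Bałaban, *Propagators for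
lattice gauge theories in a background field*, Commun. Math. Phys. **99** (1985) 389–434 [`Balaban1985BackgroundPropagators`, "B9"].
statement-level skeleton of published theorems with citation tags; proofs where landed; nothing here is a claim about the Yang–Mills mass gap.

THE PRINT.  [B7] p. 38 (Prop. 4) *«for α₀ sufficiently small»*, p. 41 after (155) *«C₃ > C″₁ … if α₀ and b are sufficiently small»*, p. 42 Prop. 5; [B9] p. 396 *«We will
need α₀ so small that O(1)Mα₀ is still a sufficiently small number»*.  The tree's explicit editions of these windows (`B7Prop5GeneralLevels`: `C0 d·α₀ ≤ ⅓`, `4α₀ ≤ c₂′`,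
`(145)`, `(155)`, the Prop.-4 factor `e^{4·800(d+1)²(d+4)α₀}(1 + 8·131072(d+1)²b) ≤ 2`, `4b < c₃`) and the N06 certificate's plaquette threshold (`B9C2FormBoxRegimeY.Kpl`:
`2(10La)(1+10La)e^{40La}·L⁴ < α₀′`) are JOINTLY SATISFIABLE at every `(d+1, ℓ+1)` with `ℓ + 1 ≥ 2` — this file gives the witnesses.

WHY THIS FILE (seat dag-n06-l g34, programme P-C2).  The fold of the N06 certificate's letter `hC2` (`B9C2FormMajTorusLettersAtMemberY.c2FormMaj_c2YOfRecord`) displays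
exactly these numerics (in the spellings below, `d ↦ θ.d₆`, `ℓ ↦ θ.ℓ₆`); the certificate's numerics witness (`…N06NumericsWitnessT`, stated for ALL `d, ℓ`) must inhabit
them — `b7Window_inhabited` ∕ `b7Window_inhabited_le` ∕ `kappaC_inhabited` are the one-line suppliers.

WHAT THIS FILE PROVES (0 sorry).  §1 the constants unfolded at `(d+1, ℓ+1)`; §2 the witnesses `alpha0W d ℓ := 1∕(2³⁰(d+5)⁴(ℓ+1)^{d+2})`, `bbW d ℓ := 1∕(2³⁰·131072·(d+5)³(ℓ+1)^{d+3})`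
and the eight inequalities one by one; §3 ★★★ `b7Window_inhabited` (∃ α₀′ bb, window ∧ ∀ a ≤ α₀′∕(128L⁵), plaquette threshold), `b7Window_inhabited_le` (∃ α₀′ bb a with
`0 < a ≤ amax`), `kappaC_inhabited`.
-/

noncomputable section

namespace Literature.MathematicalPhysics.QuantumFieldTheory.Balaban1983to89.B7Prop5WindowNumerics

open B7Prop2Explicit (C0 c2')
open B7Prop3Flat (c3)
open B7Prop5GeneralLevels (C3Gen thetaGen C1ppGen)

/-! ## §1 The constants at `(d+1, ℓ+1)`, unfolded -/

/-- `θ(d+1, ℓ+1, α) = 3200(d+2)(d+5)(ℓ+1)^{d+2}·α`. [cite: Balaban1985Averaging, (141) p.39, bookkeeping] -/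
theorem thetaGen_succ (d ℓ : ℕ) (α : ℝ) :
    thetaGen (d + 1) (ℓ + 1) α = 3200 * (((d : ℝ) + 2) * ((d : ℝ) + 5)) * ((ℓ : ℝ) + 1) ^ (d + 2) * α := by
  unfold thetaGen; push_cast; ring

/-- `C₃(d+1, ℓ+1) = 64·131072·(d+2)²·(ℓ+1)^{d+3}`. [cite: Balaban1985Averaging, (155) p.41, bookkeeping] -/
theorem C3Gen_succ (d ℓ : ℕ) : C3Gen (d + 1) (ℓ + 1) = 64 * 131072 * ((d : ℝ) + 2) ^ 2 * ((ℓ : ℝ) + 1) ^ (d + 3) := by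
  unfold C3Gen C1ppGen; push_cast; ring

/-- `C₀(d+1) = 226·64·(d+2)²(d+5)²`. [cite: Balaban1985Averaging, (51) p.26, bookkeeping] -/
theorem C0_succ (d : ℕ) : C0 (d + 1) = 226 * 64 * (((d : ℝ) + 2) * ((d : ℝ) + 5)) ^ 2 := by
  unfold C0; push_cast; ring

/-- `c₂′(d+1, ℓ+1) = 1∕(512(d+2)(d+5)(ℓ+1)²)`. [cite: Balaban1985Averaging, (51) p.26, bookkeeping] -/
theorem c2'_succ (d ℓ : ℕ) : c2' (d + 1) (ℓ + 1) = 1 / (512 * (((d : ℝ) + 2) * ((d : ℝ) + 5)) * ((ℓ : ℝ) + 1) ^ 2) := by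
  unfold c2'; push_cast; ring

/-- `c₃(d+1, ℓ+1) = 1∕(128(d+2)(ℓ+1))`. [cite: Balaban1985Averaging, (122) p.36, bookkeeping] -/
theorem c3_succ (d ℓ : ℕ) : c3 (d + 1) (ℓ + 1) = 1 / (128 * ((d : ℝ) + 2) * ((ℓ : ℝ) + 1)) := by
  unfold c3; push_cast; ring

/-! ## §2 The witnesses -/

/-- the window's `α₀′(d, ℓ) := 1 ∕ (2³⁰·(d+5)⁴·(ℓ+1)^{d+2})`. [cite: Balaban1985Averaging, Proposition 5 p.42 («α₀ sufficiently small»)] -/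
def alpha0W (d ℓ : ℕ) : ℝ := 1 / (2 ^ 30 * ((d : ℝ) + 5) ^ 4 * ((ℓ : ℝ) + 1) ^ (d + 2))

/-- the window's radius `b(d, ℓ) := 1 ∕ (2³⁰·131072·(d+5)³·(ℓ+1)^{d+3})`. [cite: Balaban1985Averaging, (155) p.41 («b sufficiently small»)] -/
def bbW (d ℓ : ℕ) : ℝ := 1 / (2 ^ 30 * 131072 * ((d : ℝ) + 5) ^ 3 * ((ℓ : ℝ) + 1) ^ (d + 3))

variable (d ℓ : ℕ)

/-- `5 ≤ d + 5`. [folklore] -/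
private theorem hA5 : (5 : ℝ) ≤ (d : ℝ) + 5 := by have : (0 : ℝ) ≤ d := Nat.cast_nonneg d; linarith
/-- `1 ≤ ℓ + 1`. [folklore] -/
private theorem hL1 : (1 : ℝ) ≤ (ℓ : ℝ) + 1 := by have : (0 : ℝ) ≤ ℓ := Nat.cast_nonneg ℓ; linarith
/-- `1 ≤ (ℓ+1)^{d+2}`. [folklore] -/
private theorem hP1 : (1 : ℝ) ≤ ((ℓ : ℝ) + 1) ^ (d + 2) := one_le_pow₀ (hL1 ℓ)
/-- `1 ≤ (ℓ+1)^{d+3}`. [folklore] -/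
private theorem hQ1 : (1 : ℝ) ≤ ((ℓ : ℝ) + 1) ^ (d + 3) := one_le_pow₀ (hL1 ℓ)
/-- `(ℓ+1)² ≤ (ℓ+1)^{d+2}`. [folklore] -/
private theorem hL2P : ((ℓ : ℝ) + 1) ^ 2 ≤ ((ℓ : ℝ) + 1) ^ (d + 2) := pow_le_pow_right₀ (hL1 ℓ) (by omega)

/-- `0 < α₀′`. [cite: Balaban1985Averaging, Proposition 5 p.42, bookkeeping] -/
theorem alpha0W_pos : 0 < alpha0W d ℓ := by unfold alpha0W; have := hA5 d; have := hP1 d ℓ; positivity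

/-- `0 < b`. [cite: Balaban1985Averaging, (155) p.41, bookkeeping] -/
theorem bbW_pos : 0 < bbW d ℓ := by unfold bbW; have := hA5 d; have := hQ1 d ℓ; positivity

/-- `α₀′ ≤ 1∕X` whenever `X ≤ 2³⁰(d+5)⁴(ℓ+1)^{d+2}`. [cite: Balaban1985Averaging, Proposition 5 p.42, bookkeeping] -/
theorem alpha0W_le_one_div {X : ℝ} (hX : 0 < X) (hle : X ≤ 2 ^ 30 * ((d : ℝ) + 5) ^ 4 * ((ℓ : ℝ) + 1) ^ (d + 2)) : alpha0W d ℓ ≤ 1 / X := by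
  unfold alpha0W; exact one_div_le_one_div_of_le hX hle

/-- `b ≤ 1∕X` whenever `X ≤ 2³⁰·131072·(d+5)³(ℓ+1)^{d+3}`. [cite: Balaban1985Averaging, (155) p.41, bookkeeping] -/
theorem bbW_le_one_div {X : ℝ} (hX : 0 < X) (hle : X ≤ 2 ^ 30 * 131072 * ((d : ℝ) + 5) ^ 3 * ((ℓ : ℝ) + 1) ^ (d + 3)) : bbW d ℓ ≤ 1 / X := by
  unfold bbW; exact one_div_le_one_div_of_le hX hle

/-- (hα3) `C₀(d+1)·α₀′ ≤ ⅓`. [cite: Balaban1985Averaging, Proposition 4 p.38 (hypothesis `C₀α₀ ≤ ⅓`)] -/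
theorem hα3_b7W : C0 (d + 1) * alpha0W d ℓ ≤ 1 / 3 := by
  have hA := hA5 d; have hP := hP1 d ℓ; have hd0 : (0 : ℝ) ≤ d := Nat.cast_nonneg d
  have hC0 : 0 < C0 (d + 1) := by rw [C0_succ]; positivity
  have h : alpha0W d ℓ ≤ 1 / (3 * C0 (d + 1)) := by
    refine alpha0W_le_one_div d ℓ (by positivity) ?_
    rw [C0_succ]
    calc 3 * (226 * 64 * (((d : ℝ) + 2) * ((d : ℝ) + 5)) ^ 2) ≤ 3 * (226 * 64 * ((((d : ℝ) + 5)) * ((d : ℝ) + 5)) ^ 2) := by gcongr; linarith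
      _ = 43392 * ((d : ℝ) + 5) ^ 4 * 1 := by ring
      _ ≤ 2 ^ 30 * ((d : ℝ) + 5) ^ 4 * ((ℓ : ℝ) + 1) ^ (d + 2) := by gcongr; norm_num
  calc C0 (d + 1) * alpha0W d ℓ ≤ C0 (d + 1) * (1 / (3 * C0 (d + 1))) := mul_le_mul_of_nonneg_left h hC0.le
    _ = 1 / 3 := by field_simp

/-- (hα4) `4α₀′ ≤ c₂′(d+1, ℓ+1)`. [cite: Balaban1985Averaging, (51) p.26, Proposition 4 p.38] -/
theorem hα4_b7W : 4 * alpha0W d ℓ ≤ c2' (d + 1) (ℓ + 1) := by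
  have hA := hA5 d; have hP := hL2P d ℓ; have hd0 : (0 : ℝ) ≤ d := Nat.cast_nonneg d; have hl := hL1 ℓ
  have h : alpha0W d ℓ ≤ 1 / (4 * (512 * (((d : ℝ) + 2) * ((d : ℝ) + 5)) * ((ℓ : ℝ) + 1) ^ 2)) := by
    refine alpha0W_le_one_div d ℓ (by positivity) ?_
    calc 4 * (512 * (((d : ℝ) + 2) * ((d : ℝ) + 5)) * ((ℓ : ℝ) + 1) ^ 2) ≤ 4 * (512 * ((((d : ℝ) + 5)) * ((d : ℝ) + 5)) * ((ℓ : ℝ) + 1) ^ (d + 2)) := by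
          gcongr; linarith
      _ = 2048 * 1 * 1 * ((d : ℝ) + 5) ^ 2 * ((ℓ : ℝ) + 1) ^ (d + 2) := by ring
      _ ≤ 2 ^ 30 * ((d : ℝ) + 5) * ((d : ℝ) + 5) * ((d : ℝ) + 5) ^ 2 * ((ℓ : ℝ) + 1) ^ (d + 2) := by gcongr <;> linarith
      _ = 2 ^ 30 * ((d : ℝ) + 5) ^ 4 * ((ℓ : ℝ) + 1) ^ (d + 2) := by ring
  rw [c2'_succ]
  calc 4 * alpha0W d ℓ ≤ 4 * (1 / (4 * (512 * (((d : ℝ) + 2) * ((d : ℝ) + 5)) * ((ℓ : ℝ) + 1) ^ 2))) := by gcongr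
    _ = 1 / (512 * (((d : ℝ) + 2) * ((d : ℝ) + 5)) * ((ℓ : ℝ) + 1) ^ 2) := by field_simp

/-- (h145) `8(d+1)·θ(α₀′)·(ℓ+1)⁻⁴ ≤ 1`. [cite: Balaban1985Averaging, (145) p.40] -/
theorem h145_b7W : 8 * ((d + 1 : ℕ) : ℝ) * thetaGen (d + 1) (ℓ + 1) (alpha0W d ℓ) * ((ℓ : ℝ) + 1)⁻¹ ^ 4 ≤ 1 := by
  have hA := hA5 d; have hP := hP1 d ℓ; have hd0 : (0 : ℝ) ≤ d := Nat.cast_nonneg d; have hl := hL1 ℓ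
  have hinv : ((ℓ : ℝ) + 1)⁻¹ ^ 4 ≤ 1 := pow_le_one₀ (by positivity) (inv_le_one_of_one_le₀ hl)
  -- `8(d+1)·θ(α₀′) ≤ 1`
  have hθ : 8 * ((d + 1 : ℕ) : ℝ) * thetaGen (d + 1) (ℓ + 1) (alpha0W d ℓ) ≤ 1 := by
    rw [thetaGen_succ]; push_cast
    have h : alpha0W d ℓ ≤ 1 / (8 * ((d : ℝ) + 1) * (3200 * (((d : ℝ) + 2) * ((d : ℝ) + 5)) * ((ℓ : ℝ) + 1) ^ (d + 2))) := by
      refine alpha0W_le_one_div d ℓ (by positivity) ?_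
      calc 8 * ((d : ℝ) + 1) * (3200 * (((d : ℝ) + 2) * ((d : ℝ) + 5)) * ((ℓ : ℝ) + 1) ^ (d + 2))
            ≤ 8 * ((d : ℝ) + 5) * (3200 * ((((d : ℝ) + 5)) * ((d : ℝ) + 5)) * ((ℓ : ℝ) + 1) ^ (d + 2)) := by gcongr <;> linarith
        _ = 25600 * 1 * ((d : ℝ) + 5) ^ 3 * ((ℓ : ℝ) + 1) ^ (d + 2) := by ring
        _ ≤ 2 ^ 30 * ((d : ℝ) + 5) * ((d : ℝ) + 5) ^ 3 * ((ℓ : ℝ) + 1) ^ (d + 2) := by gcongr <;> linarith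
        _ = 2 ^ 30 * ((d : ℝ) + 5) ^ 4 * ((ℓ : ℝ) + 1) ^ (d + 2) := by ring
    calc 8 * ((d : ℝ) + 1) * (3200 * (((d : ℝ) + 2) * ((d : ℝ) + 5)) * ((ℓ : ℝ) + 1) ^ (d + 2) * alpha0W d ℓ)
          = (8 * ((d : ℝ) + 1) * (3200 * (((d : ℝ) + 2) * ((d : ℝ) + 5)) * ((ℓ : ℝ) + 1) ^ (d + 2))) * alpha0W d ℓ := by ring
      _ ≤ (8 * ((d : ℝ) + 1) * (3200 * (((d : ℝ) + 2) * ((d : ℝ) + 5)) * ((ℓ : ℝ) + 1) ^ (d + 2))) *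
            (1 / (8 * ((d : ℝ) + 1) * (3200 * (((d : ℝ) + 2) * ((d : ℝ) + 5)) * ((ℓ : ℝ) + 1) ^ (d + 2)))) := by gcongr
      _ = 1 := by field_simp
  have h0 : 0 ≤ 8 * ((d + 1 : ℕ) : ℝ) * thetaGen (d + 1) (ℓ + 1) (alpha0W d ℓ) := by
    rw [thetaGen_succ]; have := (alpha0W_pos d ℓ).le; positivity
  calc _ ≤ 1 * 1 := mul_le_mul hθ hinv (by positivity) zero_le_one
    _ = 1 := one_mul _

/-- `2(d+1)·θ(α₀′) ≤ 1∕16` (the (155) budget's θ-share). [cite: Balaban1985Averaging, (155) p.41, bookkeeping] -/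
theorem two_mul_theta_b7W_le : 2 * ((d + 1 : ℕ) : ℝ) * thetaGen (d + 1) (ℓ + 1) (alpha0W d ℓ) ≤ 1 / 16 := by
  have hA := hA5 d; have hP := hP1 d ℓ; have hd0 : (0 : ℝ) ≤ d := Nat.cast_nonneg d; have hl := hL1 ℓ
  rw [thetaGen_succ]; push_cast
  have h : alpha0W d ℓ ≤ 1 / (16 * (2 * ((d : ℝ) + 1) * (3200 * (((d : ℝ) + 2) * ((d : ℝ) + 5)) * ((ℓ : ℝ) + 1) ^ (d + 2)))) := by
    refine alpha0W_le_one_div d ℓ (by positivity) ?_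
    calc 16 * (2 * ((d : ℝ) + 1) * (3200 * (((d : ℝ) + 2) * ((d : ℝ) + 5)) * ((ℓ : ℝ) + 1) ^ (d + 2)))
          ≤ 16 * (2 * ((d : ℝ) + 5) * (3200 * ((((d : ℝ) + 5)) * ((d : ℝ) + 5)) * ((ℓ : ℝ) + 1) ^ (d + 2))) := by gcongr <;> linarith
      _ = 102400 * 1 * ((d : ℝ) + 5) ^ 3 * ((ℓ : ℝ) + 1) ^ (d + 2) := by ring
      _ ≤ 2 ^ 30 * ((d : ℝ) + 5) * ((d : ℝ) + 5) ^ 3 * ((ℓ : ℝ) + 1) ^ (d + 2) := by gcongr <;> linarith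
      _ = 2 ^ 30 * ((d : ℝ) + 5) ^ 4 * ((ℓ : ℝ) + 1) ^ (d + 2) := by ring
  calc 2 * ((d : ℝ) + 1) * (3200 * (((d : ℝ) + 2) * ((d : ℝ) + 5)) * ((ℓ : ℝ) + 1) ^ (d + 2) * alpha0W d ℓ)
        = (2 * ((d : ℝ) + 1) * (3200 * (((d : ℝ) + 2) * ((d : ℝ) + 5)) * ((ℓ : ℝ) + 1) ^ (d + 2))) * alpha0W d ℓ := by ring
    _ ≤ (2 * ((d : ℝ) + 1) * (3200 * (((d : ℝ) + 2) * ((d : ℝ) + 5)) * ((ℓ : ℝ) + 1) ^ (d + 2))) *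
          (1 / (16 * (2 * ((d : ℝ) + 1) * (3200 * (((d : ℝ) + 2) * ((d : ℝ) + 5)) * ((ℓ : ℝ) + 1) ^ (d + 2))))) := by gcongr
    _ = 1 / 16 := by field_simp

/-- `2(d+1)·C₃(d+1, ℓ+1)·b ≤ 1∕16` (the (155) budget's b-share). [cite: Balaban1985Averaging, (155) p.41, bookkeeping] -/
theorem two_mul_C3_bbW_b7W_le : 2 * ((d + 1 : ℕ) : ℝ) * C3Gen (d + 1) (ℓ + 1) * bbW d ℓ ≤ 1 / 16 := by
  have hA := hA5 d; have hQ := hQ1 d ℓ; have hd0 : (0 : ℝ) ≤ d := Nat.cast_nonneg d; have hl := hL1 ℓ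
  rw [C3Gen_succ]; push_cast
  have h : bbW d ℓ ≤ 1 / (16 * (2 * ((d : ℝ) + 1) * (64 * 131072 * ((d : ℝ) + 2) ^ 2 * ((ℓ : ℝ) + 1) ^ (d + 3)))) := by
    refine bbW_le_one_div d ℓ (by positivity) ?_
    calc 16 * (2 * ((d : ℝ) + 1) * (64 * 131072 * ((d : ℝ) + 2) ^ 2 * ((ℓ : ℝ) + 1) ^ (d + 3)))
          ≤ 16 * (2 * ((d : ℝ) + 5) * (64 * 131072 * ((d : ℝ) + 5) ^ 2 * ((ℓ : ℝ) + 1) ^ (d + 3))) := by gcongr <;> linarith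
      _ = 2048 * 131072 * ((d : ℝ) + 5) ^ 3 * ((ℓ : ℝ) + 1) ^ (d + 3) := by ring
      _ ≤ 2 ^ 30 * 131072 * ((d : ℝ) + 5) ^ 3 * ((ℓ : ℝ) + 1) ^ (d + 3) := by gcongr; norm_num
  calc 2 * ((d : ℝ) + 1) * (64 * 131072 * ((d : ℝ) + 2) ^ 2 * ((ℓ : ℝ) + 1) ^ (d + 3)) * bbW d ℓ
        ≤ 2 * ((d : ℝ) + 1) * (64 * 131072 * ((d : ℝ) + 2) ^ 2 * ((ℓ : ℝ) + 1) ^ (d + 3)) *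
          (1 / (16 * (2 * ((d : ℝ) + 1) * (64 * 131072 * ((d : ℝ) + 2) ^ 2 * ((ℓ : ℝ) + 1) ^ (d + 3))))) := by gcongr
    _ = 1 / 16 := by field_simp

/-- (h155) the (155) budget at `(α₀′, b)`, for `ℓ + 1 ≥ 2`. [cite: Balaban1985Averaging, (155) p.41] -/
theorem h155_b7W (hℓ : 2 ≤ ℓ + 1) :
    (2 * ((ℓ : ℝ) + 1) - 1) * ((ℓ : ℝ) + 1)⁻¹ ^ 2 + 2 * ((d + 1 : ℕ) : ℝ) * thetaGen (d + 1) (ℓ + 1) (alpha0W d ℓ) * ((ℓ : ℝ) + 1)⁻¹ ^ 3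
      + 1 / 8 * (1 + 2 * ((d + 1 : ℕ) : ℝ) * thetaGen (d + 1) (ℓ + 1) (alpha0W d ℓ) * ((ℓ : ℝ) + 1)⁻¹ ^ 2
        + 2 * ((d + 1 : ℕ) : ℝ) * C3Gen (d + 1) (ℓ + 1) * bbW d ℓ) * ((ℓ : ℝ) + 1)⁻¹ ^ 2 ≤ 1 := by
  have hl2 : (2 : ℝ) ≤ (ℓ : ℝ) + 1 := by exact_mod_cast hℓ
  set u : ℝ := ((ℓ : ℝ) + 1)⁻¹ with hu
  have hu0 : 0 < u := by rw [hu]; positivity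
  have huL : ((ℓ : ℝ) + 1) * u = 1 := by rw [hu]; exact mul_inv_cancel₀ (by positivity)
  have hu2 : u ≤ 1 / 2 := by rw [hu]; rw [inv_eq_one_div]; exact one_div_le_one_div_of_le (by norm_num) hl2
  set T : ℝ := 2 * ((d + 1 : ℕ) : ℝ) * thetaGen (d + 1) (ℓ + 1) (alpha0W d ℓ) with hT
  set B : ℝ := 2 * ((d + 1 : ℕ) : ℝ) * C3Gen (d + 1) (ℓ + 1) * bbW d ℓ with hB
  have hT0 : 0 ≤ T := by rw [hT, thetaGen_succ]; have := (alpha0W_pos d ℓ).le; positivity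
  have hB0 : 0 ≤ B := by rw [hB, C3Gen_succ]; have := (bbW_pos d ℓ).le; positivity
  have hT1 : T ≤ 1 / 16 := two_mul_theta_b7W_le d ℓ
  have hB1 : B ≤ 1 / 16 := two_mul_C3_bbW_b7W_le d ℓ
  -- in the variable `u = L⁻¹` with `L·u = 1`: `(2L−1)u² = 2u − u²`
  have h1 : (2 * ((ℓ : ℝ) + 1) - 1) * u ^ 2 = 2 * u - u ^ 2 := by
    have : (2 * ((ℓ : ℝ) + 1) - 1) * u ^ 2 = 2 * (((ℓ : ℝ) + 1) * u) * u - u ^ 2 := by ring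
    rw [this, huL]; ring
  rw [h1]
  have hTu3 : T * u ^ 3 ≤ 1 / 16 * (1 / 8) := by
    calc T * u ^ 3 ≤ 1 / 16 * (1 / 2) ^ 3 := by gcongr
      _ = 1 / 16 * (1 / 8) := by norm_num
  have hTu2 : T * u ^ 2 ≤ 1 / 16 * 1 := by
    calc T * u ^ 2 ≤ 1 / 16 * (1 / 2) ^ 2 := by gcongr
      _ ≤ 1 / 16 * 1 := by norm_num
  have hu2sq : u ^ 2 ≤ 1 / 4 := by nlinarith
  nlinarith [sq_nonneg (1 - u), mul_nonneg hT0 (pow_nonneg hu0.le 3), mul_nonneg hB0 (pow_nonneg hu0.le 2), pow_nonneg hu0.le 2]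

/-- (hsmall) the Prop.-4 factor `e^{4·800(d+2)²(d+5)α₀′}·(1 + 8·131072(d+2)²·b) ≤ 2`. [cite: Balaban1985Averaging, Proposition 4 p.38, (131) p.37] -/
theorem hsmall_b7W :
    Real.exp (4 * (800 * (((d + 1 : ℕ) : ℝ) + 1) ^ 2 * (((d + 1 : ℕ) : ℝ) + 4)) * alpha0W d ℓ) * (1 + 8 * (131072 * (((d + 1 : ℕ) : ℝ) + 1) ^ 2) * bbW d ℓ) ≤ 2 := by
  have hA := hA5 d; have hP := hP1 d ℓ; have hQ := hQ1 d ℓ; have hd0 : (0 : ℝ) ≤ d := Nat.cast_nonneg d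
  have e2 : (((d + 1 : ℕ) : ℝ) + 1) = (d : ℝ) + 2 := by push_cast; ring
  have e5 : (((d + 1 : ℕ) : ℝ) + 4) = (d : ℝ) + 5 := by push_cast; ring
  rw [e2, e5]
  set x : ℝ := 4 * (800 * ((d : ℝ) + 2) ^ 2 * ((d : ℝ) + 5)) * alpha0W d ℓ with hx
  set y : ℝ := 8 * (131072 * ((d : ℝ) + 2) ^ 2) * bbW d ℓ with hy
  have hx0 : 0 ≤ x := by rw [hx]; have := (alpha0W_pos d ℓ).le; positivity
  have hy0 : 0 ≤ y := by rw [hy]; have := (bbW_pos d ℓ).le; positivity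
  have hx1 : x ≤ 1 / 8 := by
    have h : alpha0W d ℓ ≤ 1 / (8 * (4 * (800 * ((d : ℝ) + 2) ^ 2 * ((d : ℝ) + 5)))) := by
      refine alpha0W_le_one_div d ℓ (by positivity) ?_
      calc 8 * (4 * (800 * ((d : ℝ) + 2) ^ 2 * ((d : ℝ) + 5))) ≤ 8 * (4 * (800 * ((d : ℝ) + 5) ^ 2 * ((d : ℝ) + 5))) := by
            gcongr; linarith
        _ = 25600 * 1 * ((d : ℝ) + 5) ^ 3 * 1 := by ring
        _ ≤ 2 ^ 30 * ((d : ℝ) + 5) * ((d : ℝ) + 5) ^ 3 * ((ℓ : ℝ) + 1) ^ (d + 2) := by gcongr <;> linarith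
        _ = 2 ^ 30 * ((d : ℝ) + 5) ^ 4 * ((ℓ : ℝ) + 1) ^ (d + 2) := by ring
    calc x = (4 * (800 * ((d : ℝ) + 2) ^ 2 * ((d : ℝ) + 5))) * alpha0W d ℓ := by rw [hx]
      _ ≤ (4 * (800 * ((d : ℝ) + 2) ^ 2 * ((d : ℝ) + 5))) * (1 / (8 * (4 * (800 * ((d : ℝ) + 2) ^ 2 * ((d : ℝ) + 5))))) := by gcongr
      _ = 1 / 8 := by field_simp
  have hy1 : y ≤ 1 / 4 := by
    have h : bbW d ℓ ≤ 1 / (4 * (8 * (131072 * ((d : ℝ) + 2) ^ 2))) := by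
      refine bbW_le_one_div d ℓ (by positivity) ?_
      calc 4 * (8 * (131072 * ((d : ℝ) + 2) ^ 2)) ≤ 4 * (8 * (131072 * ((d : ℝ) + 5) ^ 2)) := by gcongr; linarith
        _ = 32 * 131072 * (((d : ℝ) + 5) ^ 2 * 1) * 1 := by ring
        _ ≤ 2 ^ 30 * 131072 * (((d : ℝ) + 5) ^ 2 * ((d : ℝ) + 5)) * ((ℓ : ℝ) + 1) ^ (d + 3) := by gcongr <;> linarith
        _ = 2 ^ 30 * 131072 * ((d : ℝ) + 5) ^ 3 * ((ℓ : ℝ) + 1) ^ (d + 3) := by ring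
    calc y = (8 * (131072 * ((d : ℝ) + 2) ^ 2)) * bbW d ℓ := by rw [hy]
      _ ≤ (8 * (131072 * ((d : ℝ) + 2) ^ 2)) * (1 / (4 * (8 * (131072 * ((d : ℝ) + 2) ^ 2)))) := by gcongr
      _ = 1 / 4 := by field_simp
  -- `e^x ≤ 1 + 2x` on `|x| ≤ 1`
  have hexp : Real.exp x ≤ 1 + 2 * x := by
    have habs : |x| ≤ 1 := by rw [abs_of_nonneg hx0]; linarith
    have h := Real.abs_exp_sub_one_le habs
    rw [abs_of_nonneg hx0] at h
    linarith [le_abs_self (Real.exp x - 1)]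
  calc Real.exp x * (1 + y) ≤ (1 + 2 * x) * (1 + y) := by gcongr
    _ ≤ (1 + 2 * (1 / 8)) * (1 + 1 / 4) := by gcongr
    _ ≤ 2 := by norm_num

/-- (hc₃) `4b < c₃(d+1, ℓ+1)`. [cite: Balaban1985Averaging, (122) p.36, (155) p.41] -/
theorem hc3_b7W : 4 * bbW d ℓ < c3 (d + 1) (ℓ + 1) := by
  have hA := hA5 d; have hQ := hQ1 d ℓ; have hd0 : (0 : ℝ) ≤ d := Nat.cast_nonneg d; have hl := hL1 ℓ
  rw [c3_succ]
  have h : bbW d ℓ ≤ 1 / (8 * (128 * ((d : ℝ) + 2) * ((ℓ : ℝ) + 1))) := by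
    refine bbW_le_one_div d ℓ (by positivity) ?_
    have hLQ : ((ℓ : ℝ) + 1) ≤ ((ℓ : ℝ) + 1) ^ (d + 3) := by
      calc ((ℓ : ℝ) + 1) = ((ℓ : ℝ) + 1) ^ 1 := (pow_one _).symm
        _ ≤ ((ℓ : ℝ) + 1) ^ (d + 3) := pow_le_pow_right₀ hl (by omega)
    calc 8 * (128 * ((d : ℝ) + 2) * ((ℓ : ℝ) + 1)) ≤ 8 * (128 * ((d : ℝ) + 5) * ((ℓ : ℝ) + 1) ^ (d + 3)) := by gcongr; linarith
      _ = 1024 * 1 * (((d : ℝ) + 5) * 1) * ((ℓ : ℝ) + 1) ^ (d + 3) := by ring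
      _ ≤ 2 ^ 30 * 131072 * (((d : ℝ) + 5) * ((d : ℝ) + 5) ^ 2) * ((ℓ : ℝ) + 1) ^ (d + 3) := by gcongr <;> nlinarith
      _ = 2 ^ 30 * 131072 * ((d : ℝ) + 5) ^ 3 * ((ℓ : ℝ) + 1) ^ (d + 3) := by ring
  have hX : 0 < 128 * ((d : ℝ) + 2) * ((ℓ : ℝ) + 1) := by positivity
  calc 4 * bbW d ℓ ≤ 4 * (1 / (8 * (128 * ((d : ℝ) + 2) * ((ℓ : ℝ) + 1)))) := by gcongr
    _ = 1 / (2 * (128 * ((d : ℝ) + 2) * ((ℓ : ℝ) + 1))) := by field_simp; ring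
    _ < 1 / (128 * ((d : ℝ) + 2) * ((ℓ : ℝ) + 1)) := one_div_lt_one_div_of_lt hX (by linarith)

/-- (hKa) the plaquette threshold: for `0 ≤ a ≤ α₀′∕(128·(ℓ+1)⁵)`, `2(10La)(1+10La)e^{40La}·L⁴ < α₀′` (`L = ℓ+1`). [cite: Balaban1985BackgroundPropagators, (3.35) p.396] -/
theorem hKa_b7W {a : ℝ} (ha : 0 ≤ a) (hale : a ≤ alpha0W d ℓ / (128 * ((ℓ : ℝ) + 1) ^ 5)) :
    2 * (10 * ((ℓ : ℝ) + 1) * a) * (1 + 10 * ((ℓ : ℝ) + 1) * a) * Real.exp (4 * (10 * ((ℓ : ℝ) + 1) * a)) * ((ℓ : ℝ) + 1) ^ 4 < alpha0W d ℓ := by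
  have hl := hL1 ℓ; have hα := alpha0W_pos d ℓ
  -- `α₀′ ≤ 1` (so `y = 10La ≤ 10α₀′∕128 ≤ 1∕8`)
  have hα1 : alpha0W d ℓ ≤ 1 := by
    have h := alpha0W_le_one_div d ℓ one_pos (by
      have hA := hA5 d; have hP := hP1 d ℓ
      calc (1 : ℝ) = 1 * 1 * 1 := by ring
        _ ≤ 2 ^ 30 * ((d : ℝ) + 5) ^ 4 * ((ℓ : ℝ) + 1) ^ (d + 2) := by
            gcongr
            · norm_num
            · nlinarith [pow_le_pow_left₀ (by norm_num : (0:ℝ) ≤ 5) hA 4])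
    simpa using h
  set y : ℝ := 10 * ((ℓ : ℝ) + 1) * a with hy
  have hy0 : 0 ≤ y := by rw [hy]; positivity
  have hL5 : (0 : ℝ) < ((ℓ : ℝ) + 1) ^ 5 := by positivity
  have hL4 : ((ℓ : ℝ) + 1) ^ 4 * ((ℓ : ℝ) + 1) = ((ℓ : ℝ) + 1) ^ 5 := by ring
  -- `y·L⁴ ≤ 10α₀′∕128`
  have hyL : y * ((ℓ : ℝ) + 1) ^ 4 ≤ 10 * alpha0W d ℓ / 128 := by
    rw [hy]
    calc 10 * ((ℓ : ℝ) + 1) * a * ((ℓ : ℝ) + 1) ^ 4 = 10 * (a * ((ℓ : ℝ) + 1) ^ 5) := by ring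
      _ ≤ 10 * (alpha0W d ℓ / (128 * ((ℓ : ℝ) + 1) ^ 5) * ((ℓ : ℝ) + 1) ^ 5) := by gcongr
      _ = 10 * alpha0W d ℓ / 128 := by field_simp
  have hy1 : y ≤ 1 / 8 := by
    have hL41 : (1 : ℝ) ≤ ((ℓ : ℝ) + 1) ^ 4 := one_le_pow₀ hl
    have : y ≤ y * ((ℓ : ℝ) + 1) ^ 4 := le_mul_of_one_le_right hy0 hL41
    linarith
  have hexp : Real.exp (4 * y) ≤ 1 + 2 * (4 * y) := by
    have habs : |4 * y| ≤ 1 := by rw [abs_of_nonneg (by positivity)]; linarith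
    have h := Real.abs_exp_sub_one_le habs
    rw [abs_of_nonneg (by positivity : (0:ℝ) ≤ 4 * y)] at h
    linarith [le_abs_self (Real.exp (4 * y) - 1)]
  calc 2 * y * (1 + y) * Real.exp (4 * y) * ((ℓ : ℝ) + 1) ^ 4 ≤ 2 * y * (1 + 1 / 8) * (1 + 2 * (4 * (1 / 8))) * ((ℓ : ℝ) + 1) ^ 4 := by
        gcongr
        calc Real.exp (4 * y) ≤ 1 + 2 * (4 * y) := hexp
          _ ≤ 1 + 2 * (4 * (1 / 8)) := by linarith
    _ = 9 / 2 * (y * ((ℓ : ℝ) + 1) ^ 4) := by ring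
    _ ≤ 9 / 2 * (10 * alpha0W d ℓ / 128) := by gcongr
    _ < alpha0W d ℓ := by linarith

/-! ## §3 The window is inhabited -/

/-- ★★★ **THE B7 SMALLNESS WINDOW OF THE N06 LETTER `hC2` IS INHABITED** at every `(d+1, ℓ+1)` with `ℓ + 1 ≥ 2`: there are `α₀′, b > 0` satisfying `C₀α₀′ ≤ ⅓`, `4α₀′ ≤ c₂′`, the
Prop.-4 factor `≤ 2`, `4b < c₃`, (145), (155), and such that EVERY threshold `0 ≤ a ≤ α₀′∕(128L⁵)` satisfies the plaquette inequality `2(10La)(1+10La)e^{40La}·L⁴ < α₀′`.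
[cite: Balaban1985Averaging, Proposition 4 p.38, (145) p.40, (155) p.41, Proposition 5 p.42] [cite: Balaban1985BackgroundPropagators, (3.35) p.396] -/
theorem b7Window_inhabited (hℓ : 2 ≤ ℓ + 1) :
    ∃ α₀' bb : ℝ, 0 < α₀' ∧ 0 < bb ∧
      C0 (d + 1) * α₀' ≤ 1 / 3 ∧ 4 * α₀' ≤ c2' (d + 1) (ℓ + 1) ∧
      Real.exp (4 * (800 * (((d + 1 : ℕ) : ℝ) + 1) ^ 2 * (((d + 1 : ℕ) : ℝ) + 4)) * α₀') * (1 + 8 * (131072 * (((d + 1 : ℕ) : ℝ) + 1) ^ 2) * bb) ≤ 2 ∧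
      4 * bb < c3 (d + 1) (ℓ + 1) ∧
      8 * ((d + 1 : ℕ) : ℝ) * thetaGen (d + 1) (ℓ + 1) α₀' * ((ℓ : ℝ) + 1)⁻¹ ^ 4 ≤ 1 ∧
      (2 * ((ℓ : ℝ) + 1) - 1) * ((ℓ : ℝ) + 1)⁻¹ ^ 2 + 2 * ((d + 1 : ℕ) : ℝ) * thetaGen (d + 1) (ℓ + 1) α₀' * ((ℓ : ℝ) + 1)⁻¹ ^ 3
        + 1 / 8 * (1 + 2 * ((d + 1 : ℕ) : ℝ) * thetaGen (d + 1) (ℓ + 1) α₀' * ((ℓ : ℝ) + 1)⁻¹ ^ 2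
          + 2 * ((d + 1 : ℕ) : ℝ) * C3Gen (d + 1) (ℓ + 1) * bb) * ((ℓ : ℝ) + 1)⁻¹ ^ 2 ≤ 1 ∧
      ∀ a : ℝ, 0 ≤ a → a ≤ α₀' / (128 * ((ℓ : ℝ) + 1) ^ 5) →
        2 * (10 * ((ℓ : ℝ) + 1) * a) * (1 + 10 * ((ℓ : ℝ) + 1) * a) * Real.exp (4 * (10 * ((ℓ : ℝ) + 1) * a)) * ((ℓ : ℝ) + 1) ^ 4 < α₀' :=
  ⟨alpha0W d ℓ, bbW d ℓ, alpha0W_pos d ℓ, bbW_pos d ℓ, hα3_b7W d ℓ, hα4_b7W d ℓ, hsmall_b7W d ℓ, hc3_b7W d ℓ, h145_b7W d ℓ, h155_b7W d ℓ hℓ,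
    fun _ ha hale => hKa_b7W d ℓ ha hale⟩

/-- ★★★ **THE SAME WITH A THRESHOLD BELOW ANY PRESCRIBED `amax > 0`** (the certificate's `a₁₂` is shared with other letters and only bounded above there): `∃ α₀′ bb a`,
`0 < a ≤ amax`, the window, and the plaquette inequality at `a`. [cite: Balaban1985Averaging, Proposition 5 p.42] [cite: Balaban1985BackgroundPropagators, (3.35) p.396] -/
theorem b7Window_inhabited_le (hℓ : 2 ≤ ℓ + 1) {amax : ℝ} (hamax : 0 < amax) :
    ∃ α₀' bb a : ℝ, 0 < α₀' ∧ 0 < bb ∧ 0 < a ∧ a ≤ amax ∧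
      C0 (d + 1) * α₀' ≤ 1 / 3 ∧ 4 * α₀' ≤ c2' (d + 1) (ℓ + 1) ∧
      Real.exp (4 * (800 * (((d + 1 : ℕ) : ℝ) + 1) ^ 2 * (((d + 1 : ℕ) : ℝ) + 4)) * α₀') * (1 + 8 * (131072 * (((d + 1 : ℕ) : ℝ) + 1) ^ 2) * bb) ≤ 2 ∧
      4 * bb < c3 (d + 1) (ℓ + 1) ∧
      8 * ((d + 1 : ℕ) : ℝ) * thetaGen (d + 1) (ℓ + 1) α₀' * ((ℓ : ℝ) + 1)⁻¹ ^ 4 ≤ 1 ∧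
      (2 * ((ℓ : ℝ) + 1) - 1) * ((ℓ : ℝ) + 1)⁻¹ ^ 2 + 2 * ((d + 1 : ℕ) : ℝ) * thetaGen (d + 1) (ℓ + 1) α₀' * ((ℓ : ℝ) + 1)⁻¹ ^ 3
        + 1 / 8 * (1 + 2 * ((d + 1 : ℕ) : ℝ) * thetaGen (d + 1) (ℓ + 1) α₀' * ((ℓ : ℝ) + 1)⁻¹ ^ 2
          + 2 * ((d + 1 : ℕ) : ℝ) * C3Gen (d + 1) (ℓ + 1) * bb) * ((ℓ : ℝ) + 1)⁻¹ ^ 2 ≤ 1 ∧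
      2 * (10 * ((ℓ : ℝ) + 1) * a) * (1 + 10 * ((ℓ : ℝ) + 1) * a) * Real.exp (4 * (10 * ((ℓ : ℝ) + 1) * a)) * ((ℓ : ℝ) + 1) ^ 4 < α₀' := by
  have hl := hL1 ℓ
  have hq : 0 < alpha0W d ℓ / (128 * ((ℓ : ℝ) + 1) ^ 5) := div_pos (alpha0W_pos d ℓ) (by positivity)
  refine ⟨alpha0W d ℓ, bbW d ℓ, min amax (alpha0W d ℓ / (128 * ((ℓ : ℝ) + 1) ^ 5)), alpha0W_pos d ℓ, bbW_pos d ℓ, lt_min hamax hq, min_le_left _ _,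
    hα3_b7W d ℓ, hα4_b7W d ℓ, hsmall_b7W d ℓ, hc3_b7W d ℓ, h145_b7W d ℓ, h155_b7W d ℓ hℓ, hKa_b7W d ℓ (lt_min hamax hq).le (min_le_right _ _)⟩

/-- `κ_C` is inhabited: `∃ κ_C ≥ 0, C₃·e^{2δ_C(ℓ+4)} ≤ 2κ_C`. [cite: Balaban1985Averaging, (149) p.40, bookkeeping] -/
theorem kappaC_inhabited (δC : ℝ) : ∃ κC : ℝ, 0 ≤ κC ∧ C3Gen (d + 1) (ℓ + 1) * Real.exp (2 * δC * ((ℓ : ℝ) + 4)) ≤ 2 * κC := by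
  have hC3 : 0 ≤ C3Gen (d + 1) (ℓ + 1) := by rw [C3Gen_succ]; positivity
  exact ⟨C3Gen (d + 1) (ℓ + 1) * Real.exp (2 * δC * ((ℓ : ℝ) + 4)), by positivity, by linarith [mul_nonneg hC3 (Real.exp_pos (2 * δC * ((ℓ : ℝ) + 4))).le]⟩

end Literature.MathematicalPhysics.QuantumFieldTheory.Balaban1983to89.B7Prop5WindowNumerics
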